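import Mathlib
import HarnessLib
import HarnessLib.Audit
import Summits.PneNP.Statement
import Literature.Computability.Complexity.TimeBounds
import Literature.Computability.Complexity.BoolEncodings
import Literature.Computability.Complexity.Classes
import Literature.Computability.Complexity.Nondeterministic
import Literature.Computability.Complexity.Randomized
import HarnessLib.Audit.Status.Attr

/-!
Route: BavardGap

DORMANT since 2026-08-23T10:49:47Z (reconciler: no traction for 6 d (last activity item-evidence-added at 2026-08-17T08:41:29Z); parked, not closed — `ledger route dormant route-PneNP-BavardGap --off` to reactivate) — unstaffed, not closed; items shared with open routes are served there. `ledger route dormant <id> --off` reactivates.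

Route BavardGap (card PneNP/PneNP/bavard-gap-planted-genus, re-specified). Object: the pairing genus
pg(w) of a cyclic word w over F_2 = least genus of the one-vertex ribbon graph of a
letter/inverse-letter pairing (= commutator length cl(w) for reduced w, Culler1981; Bardakov's
formula cl = |w|/4 - o/2 + 1/2, Heuer2020 Thm 2.4); deciding pg(w) <= t is NP-complete (Heuer2020
Thm 1, Cor 2.5) while the LP relaxation scl(w) is computable in polynomial time (Calegari2009) and
equals log(3)|w|/(6 log|w|)(1+o(1)) on random words (CalegariWalker2013 Thm 4.1). NULL_n = uniform
reduced balanced word of length 2n.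
Thesis X (BavardGapUncertifiable, "the Bavard integrality gap of a random word cannot be
certified"): there is a constant C such that no polynomial-time SOUND genus refuter R(w,t) (R fires
only if pg(w) > t) is additively C-tight -- fires at every t < pg(w) - C -- on at least half of
NULL_n for all large n. It suffices: if P = NP the exact refuter is sound and 0-tight on every word
(PgDecisionInNP + Assembly), so X -> PneNP.
Lean (abridged; full term in the route file): ∃ C : ℕ, ∀ R : List (Fin 2 × Bool) × ℕ → Bool,
PolyTimeComputable enc encodeBool R → (∀ l t, R (l,t) = true → ¬ PgLE l t) → ∃ᶠ n in atTop, Pr_{w ∈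
RB(2n)}[∀ t, ¬ PgLE w (t+C) → R (w,t) = true] < 1/2, with PgLE w t := ∃ fixed-point-free
letter-matching involution π on Fin |w| with |w|/2 + 1 ≤ 2t + #cycles((finRotate |w|).trans π) and
RB(m) := reduced (FreeGroup.reduce-fixed) balanced words Fin m → Fin 2 × Bool.

Rationale: WHY THIS LINE. cl is NP-complete (Heuer2020 Thm 1) and its convex/stable shadow scl is an LP
solvable in polynomial time (Calegari2009; CalegariWalker2013 §5: "there is a polynomial time
algorithm to produce an extremal surface"), whose value on random words is known to first order
(CalegariWalker2013 Thm 4.1: scl = log(2k-1) n/(6 log n)(1+o(1))). So P vs NP sits in the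
INTEGRALITY GAP of Bavard duality, and the natural average-case statement is a Feige-type refutation
hypothesis: efficient certificates of genus never beat the LP by more than an additive constant on
random words (target X; as filed, `∃ C` makes X literally the C = 0 case: no sound poly-time refuter
is EXACT on half of the random words). Imported areas: geometric group theory (fatgraphs,
Culler1981; Bavard duality), probability on random words (CalegariWalker2013 comb calculus),
enumerative map theory (HarerZagier1986) for the low-degree rung, average-case complexity (Feige2002
template, KuniskyWeinBandeira2019 low degree).
PLANNER'S FINDING that fixes the regime (recorded so refuters can check it): the proof of
CalegariWalker2013 Prop 4.9 (§4.5-4.7, combs) is effective -- for fixed d the test "few long inverse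
repeats & no delta-regular comb of complexity d with L/(2d+1) > 1/2+eps" runs in time n^{O(d)},
holds for random words whp (Lemma 4.14) and fails for EVERY word of genus <= (1-eps)·theta0, theta0
= log(3)m/(6 log m) (Culler fatgraph + Lemma 3.7 averaging). Hence planted genus BELOW theta0 is
detectable in P; all known certificates (combs, the scl LP, cl >= scl + 1/2) stop at scl(w).
Hardness can only live between scl(w) and cl(w): the route plants ABOVE theta0 and asks whether cl
of a random word exceeds its scl.
REPAIR (rev 2, 2026-08-15, planner rbadge g2). (i) PlantedGenusPseudorandom (stmt-PneNP-2493) was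
refuted-MISSTATED by Theorems.BavardGapPlantedGenusPseudorandom_refuted (n = 0: theta(0) = 0 admits
no pairing while a PMF has non-empty support); replaced 1:1 by PlantedGenusPseudorandomR whose
support clause holds only EVENTUALLY in n (admissible words exist for every n >= 6, e.g. a^{n-1} b
a^{1-n} b^{-1} of genus 1 <= theta(2n)); the refuted decl stays indexed as a negative edge. (ii)
LowDegreeQuietPlanting had the same latent defect (n = 1: no reduced balanced word of length 2, f ==
1 gives 1 <= B·0) and is replaced pre-emptively by LowDegreeQuietPlantingR (support clause and
moment inequality eventually in n). (iii) PlantedGlue -> PlantedGlueR points at the repaired crux.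
(iv) Assembly restated WITHOUT the two Wave0 model-bridge hypotheses: they are the PROVED tree
theorems P_bool_eq_holds / NP_bool_eq_holds and are used inside the proof (gate audit
glue.extra-hypothesis). (v) Deciding theorem supplied: closes (hX : BavardGapUncertifiable) (hPg :
PgDecisionInNP) (hA : Assembly) : PneNP := hA hX hPg.
ROUTE-CHOICE (rev 3, 2026-08-15, planner rchoice unit, after the stmt-PneNP-2493 refutation was
queued as `substantive`). Decision: NEXT LINE, no retire. On the merits the refutation of
PlantedGenusPseudorandom is misstated-class: the proof of
Theorems.BavardGapPlantedGenusPseudorandom_refuted uses only n = 0 ((PL 0).support_nonempty against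
the empty type Fin 0), and its docstring and release note (p41558) prescribe exactly the
eventual-in-n support clause now carried by PlantedGenusPseudorandomR (stmt-PneNP-10857), which has
since been grounded NEW, survived a dedicated crux-attack (no cheap falsity: not-R needs, for some
q, a poly-time SOUND certificate 'genus > theta(1+1/q)' firing on a quarter of NULL, i.e. a
certificate beyond scl -- unknown) and been checked. Nothing load-bearing was shown false, so
retiring would discard an unrefuted line; the refuted decl stays a negative edge and is never
re-filed. The line continues on the rev-2 ladder: lead crux FirstOrderGap (2);
PlantedGenusPseudorandomR (3) -> PlantedGlueR -> X; LowDegreeQuietPlantingR (4) as evidence;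
GapDivergesInProbability (5) as the second-order lifeline; closes unchanged (hA hX hPg). NEW TREE
INPUT for whoever takes (2) / ClAsymptoticToScl / PgDecisionInNP
(Literature/GroupTheory/CombinatorialGroupTheory, landed 2026-08-15): four_mul_cl_le_of_goodChunks
(RandomSclFreeGroupUpperTail) is a deterministic SINGLE-SHEET chunk-matching bound on cl itself;
with the chunk-count tail behind CalegariWalker2013_sclUpperTail_quarter it gives cl(w) <= (log 3/4
+ eps) m/log m = (3/2 + o(1)) theta whp, so the first-order window for pg = cl of a random word is
[theta, 1.5 theta] (Calegari-Maher 2015 Thm 4.10 prints <= 3 theta; grounder note on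
stmt-PneNP-2495) and a witness q for FirstOrderGap must have q >= 2 (theta + theta/q < 1.5 theta);
proving ClAsymptoticToScl = improving one-sheet chunk matching from the constant 1/4 to the tripod
constant 1/6 (CalegariWalker2013_sclUpperTail, RandomSclFreeGroupSharpUpperTail, is multi-sheet: 4
cl(v^N') bounds). BardakovFormula_holds with BardakovFormula.commutatorLength_le_iff identifies the
inline PgLE with cl <= t for non-empty cyclically reduced words, and clLanguage_mem_NP
(CommutatorLengthNPAssembly) PROVES CL-F_r in NP by pairing certificates -- PgDecisionInNP is the
same verifier under the route's 2-bit letter code. WorstCaseFloor (stmt-PneNP-2680) can now be typed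
over the in-tree fact Heuer2020_clNPComplete (candidate signature attached there by grounder g19-9,
rc 0); it needs the extra route import CommutatorLengthNP and is left to a tenure edit so the cone
guardrail (0 unproved deps today) is re-checked deliberately -- documentation-grade, not staffed.
RANKED CRUXES. (2) FirstOrderGap: some q with Pr[pg <= theta + theta/q] -> 0, i.e. cl(random) is NOT
asymptotic to scl(random) -- decides whether an explicit planting window exists; pure
combinatorics/probability, numerically explorable. (3) PlantedGenusPseudorandomR: for every q an
exactly samplable ensemble of reduced balanced words carrying (for all large n) a pairing of genus
<= theta(1+1/q), PPT-indistinguishable (advantage < 1/4 i.o.) from NULL -- the card's planted-genus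
mechanism at supercritical genus (bands shorter than the critical length (1/2)log_3 m, camouflage
margin m^{1-2l}). (4) LowDegreeQuietPlantingR: same planting with squared low-degree likelihood
ratio (degree (log m)^2, variational form w.r.t. the non-product null) bounded for all large n --
the Harer-Zagier/Wick-calculus rung. (5) GapDivergesInProbability: cl(w) - scl(w) -> infinity in
probability -- keeps X consistent with Calegari's algorithm for every C even if (2) fails.
SUPPORT. PlantedGlueR: (2) -> (3) -> X (distinguisher = the 0-tight refuter run at threshold theta +
theta/q0 on planting parameter q = q0; provable now with IsPolyTime.ofDet_holds,
PolyTimeComputable.comp_holds). Assembly: X -> PgDecisionInNP -> PneNP (P = NP gives the exact,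
0-tight refuter; bridges P_bool_eq_holds, NP_bool_eq_holds, mem_P_iff_holds, co_P_holds are proved
tree theorems used inside the proof). PgDecisionInNP (pairing witness, cycle count; Heuer2020 Cor
2.5). CombRefutation (the effective CW lower tail: a sound poly-time refuter firing at theta -
theta/q whp; lower edge of the window). ClAsymptoticToScl = the refuting side of (2). WorstCaseFloor
(informal until a cite fact for Heuer2020 Thm 1 exists; not staffed).
KILL CRITERIA. ClAsymptoticToScl proved => no first-order window: (3),(4) lose their explicit genus,
the planted mechanism is moot and the route either restates at second order around (5) or closes.
(5) refuted together with "Bavard bound exact on half the words" (needs Calegari's algorithm as a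
fact) => X refuted, route closed (close --reason refuted:BavardGapUncertifiable). A PPT
distinguisher for supercritical planting (e.g. via exact scl statistics) refutes (3) and demotes the
line to (4)+(5). A refutation of PgDecisionInNP or Assembly would be a formalisation defect
(restate), not a kill.
HONEST STATUS. The planner's heuristic (triangle chaining along one boundary copy has slack m^{1-2l}
per junction, the same count as CW's combs) suggests cl ~ scl may hold, i.e. (2) may be FALSE; it is
ranked first precisely because it is decidable and decides everything downstream. Second-order
quantities (fluctuation windows ~ sqrt m by bounded differences; size of cl - scl) are unknown in
the literature searched.
NOT DECOMPOSED YET. The universal step beyond planting (no transfer principle is claimed: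
HolmgrenWein2021); scl statistics of planted words; the OWF form (f = boundary word of a
coin-sampled fatgraph -> WeakOWFExist, in-tree bridge pneNP_shape_of_WeakOWFExist); unitary
word-measure statistics (Magee-Puder) as alternative poly-time statistics; numerics (scallop for
scl, exhaustive pairings for cl, m <= 40) as evidence for (2)/(5).
CHEAPEST FALSIFIER. Compute cl exactly (maximise #cycles((finRotate m).trans pi) over
letter-matching involutions = Bardakov's formula, Heuer2020 Thm 2.4; feasible by branch-and-bound
for m <= 30) and scl by Calegari's LP (scallop algorithm, CalegariWalker2013 §5) on a few thousand
uniform reduced balanced words for m = 16..30 (a kit python job, hours): if cl - scl is 1/2 on the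
vast majority with no upward drift in m, then GapDivergesInProbability (5) is implausible,
FirstOrderGap (2) almost certainly false (theta ~ scl), and X reduces to "the LP certificate
ceil(scl + 1/2) is not exact on half the words" -- which the same table tests directly; a clear
"exact on > 1/2" trend kills the line. Not yet run (planner seats are compute-free; refuters run it
first).
DEGENERATE CASES CHECKED. (rev 2) theta(m) = m/(6*Nat.log 3 m) vanishes exactly for even m in
{0,2,4,10}, so no word of length 2n, n in {0,1,2,5}, admits an admissible pairing (a non-empty
reduced word has genus >= 1), and the reduced balanced set RB(2n) is empty exactly at n = 1: every
item is now either a limit / `∃ᶠ` / `∀ᶠ` statement in n or quantifies the support clause eventually,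
so these small-n facts settle nothing; for n >= 6 admissible words exist (genus-1 commutator words)
and |RB(2n)| >= 1 for n != 1 (empty word at n = 0, a^{n-1} b a^{1-n} b^{-1} for n >= 2), which the
Assembly proof uses to make the tight fraction 1.
Sources: Culler1981; Heuer2020 (Thm 1, Thm 2.4, Cor 2.5, §2.2); Calegari2009; CalegariWalker2013
(Thm 4.1, Lemma 3.7, Prop 4.2, Prop 4.9, Lemmas 4.12-4.14, §5 p.15); HarerZagier1986; Feige2002;
KuniskyWeinBandeira2019; HolmgrenWein2021; Hopkins2018; tree:
Literature.Computability.Complexity.P_bool_eq_holds, NP_bool_eq_holds, mem_P_iff_holds, co_P_holds,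
PolyTimeComputable.comp_holds, RandAlg IsPolyTime.ofDet_holds.

Novelty: NOVELTY (searched 2026-08-15 before claiming: zbMATH 'commutator length' (40 rows), 'stable
commutator length' (40 rows), 'random rigidity free group', 'word measures unitary commutator
length', 'using surfaces to solve equations in free groups'; `lit read` CalegariWalker2013 =
arXiv:1104.1768 pp.3-4, 8-13, 15 and Heuer2020 = arXiv:2001.10230 pp.2-3, 5-6; galaxy substring over
panama+pdf+crabby 'commutator length of random words' (0 hits), 'commutator length' over pdf (15
hits: scl in BS groups, free products, bounded cohomology, geodesic counting -- none
computational/average-case); the card's own S2/zbMATH sweep and the refuter audit (KLMT 2010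
quadratic equations NP-complete, generic-case complexity) accepted; S2/arXiv/OpenAlex APIs
rate-limited today, local searchd down.)
Nearest prior art: Heuer2020 (cl NP-complete; contrast with polynomial-time scl in his §1/§2.2) =
the worst-case dichotomy; CalegariWalker2013 (scl of random words to first order, comb lower bound,
poly-time extremal surfaces) = the null-model input; Calegari2009 (scl rational, LP);
Culler1981/Bardakov (cl = max-orbit pairing formula, Heuer2020 Thm 2.4); Feige2002 (refutation
hypotheses for random 3SAT as P != NP-strength statements); planted-clique/low-degree template
(Hopkins2018, KuniskyWeinBandeira2019) and its failure off symmetric ensembles (HolmgrenWein2021).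
Nothing found on: cl (as opposed to scl) of random words, the size of cl - scl on random words,
certification/refutation of genus lower boun  [refs: 1104.1768, 2001.10230, CalegariWalker2013, Heuer2020, Calegari2009, Culler1981, Feige2002, Hopkins2018, KuniskyWeinBandeira2019, HolmgrenWein2021]

Barriers (technique_class: planted-versus-null-testing, low-degree-method, lp-gap): Literature.Barriers.PneNP.LowDegreeCounterexamples: APPLIES to crux LowDegreeQuietPlanting read as
evidence and is evaded by design -- no low-degree-to-polynomial-time transfer is claimed anywhere in
the route (words are strings, not an S_n-symmetric product ensemble, exactly the setting of
HolmgrenWein2021 Thm 2); the PPT statement PlantedGenusPseudorandom is a separate crux whose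
why-might-fail names the non-low-degree threats (exact scl via Calegari's LP,
suffix-structure/compression tests), and the planner's comb-refuter finding is itself a
Holmgren-Wein-type lesson applied before opening (sub-critical planting is decodable).
Literature.Barriers.PneNP.NPHardnessToOneWayFunctions: evaded -- X is not derived from Heuer's
NP-hardness by any reduction (a non-adaptive black-box derivation would put coNP in AM);
NP-completeness is used only for the worst-case floor and for PgDecisionInNP; average-case hardness
stands on its own statistical cruxes, as for planted clique or Feige's hypothesis.
Literature.Barriers.PneNP.Relativization: applies to the target and is relocated, not evaded -- the
Assembly relativizes (P^O = NP^O gives an exact refuter relative to O), so any proof of X is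
non-relativizing; the route names no non-relativizing ingredient for the universal step; the bet is
that an explicit product-free measure on words with exactly known LP value corners the universal
step through GGT structure (fatgraphs, quasimorphisms) invisible to oracles. Honest status: it does
not e

History (route lifecycle, newest last):
- 2026-08-15T12:16:14Z · BROKEN — PlantedGenusPseudorandom (stmt-PneNP-2493, crux) refuted by Summit.PneNP.PneNP.Theorems.BavardGapPlantedGenusPseudorandom_refuted @ effcd627efb9 (refuter-rreview-route-PneNP-BavardGap-ro-14660c08-0)
- 2026-08-15T16:26:17Z · rev 2: restated PlantedGenusPseudorandom (stmt-PneNP-2493 refuted), LowDegreeQuietPlanting (stmt-PneNP-2494), PlantedGlue (stmt-PneNP-2499), Assembly (stmt-PneNP-2500) — route-repair (glue + broken item; planner rbadge g2, 2026-08-15): (1) PlantedGenusPseudorandom (stmt-PneNP-2493) refuted-MISSTATED by Theorems.BavardG (planner-rbadge-PneNP-BavardGap-0c84121b-g2-0)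
- 2026-08-15T16:26:18Z · REPAIRED (restate PlantedGenusPseudorandom, LowDegreeQuietPlanting, PlantedGlue, Assembly) — back to open: route-repair (glue + broken item; planner rbadge g2, 2026-08-15): (1) PlantedGenusPseudorandom (stmt-PneNP-2493) refuted-MISSTATED by Theorems.BavardGapPlantedG (planner-rbadge-PneNP-BavardGap-0c84121b-g2-0)
- 2026-08-16T04:13:48Z · AUTO-CRUX (backfill): BavardGapUncertifiable — hypotheses of the deciding theorem that nothing in the route derives are cruxes (operator:999:1085951)
- 2026-08-23T10:49:47Z · DORMANT — reconciler: no traction for 6 d (last activity item-evidence-added at 2026-08-17T08:41:29Z); parked, not closed — `ledger route dormant route-PneNP-BavardGap -- (operator:999:2051827)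

sub-problem: PneNP · status: dormant · opened planner-plancard-PneNP-PneNP-bavard-gap-plant-526a25bf-0 2026-08-15T11:04:46Z · rev 3 · ledger route-PneNP-BavardGap
GENERATED by the gate from the ledger (D-0016/17). Provers cite these decls: `theorem foo : Summit.PneNP.PneNP.Theses.BavardGap.<Decl> := …` in Summits/PneNP/PneNP/Theorems/<Name>.lean.
-/

namespace Summit.PneNP.PneNP.Theses.BavardGap

open scoped BigOperators Topology Manifold Classical MeasureTheory ProbabilityTheory Matrix InnerProductSpace ComplexConjugate ContinuousMap
open Filter Set Function TopologicalSpace MeasureTheory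

attribute [summit_statement] _root_.PneNP

open Literature.PNP

/-- item stmt-PneNP-2491 · crux (kind.auto-crux: conjecture-grade) · rank 0 · open · by planner
why it might fail: Dies if some efficient certificate is EXACT on half the random words, e.g. if cl(w) = ceil(scl(w)+1/2) typically (scl is poly-time, Calegari2009); unknown: no data on cl - scl of random words. Relativizes via the Assembly, so only non-relativizing proofs.
sources: Heuer2020 Thm 1, Thm 2.4, Cor 2.5, §2.2, Calegari2009, CalegariWalker2013 Thm 4.1, §5 (p.15: poly-time extremal surfaces), Feige2002 §1.1 (template), Culler1981
[target] X: for some constant C, no polynomial-time SOUND genus refuter R(w,t) (R(w,t)=true only if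
the pairing genus pg(w) > t; input boolPair(2-bit letter code of w)(unary t)) is additively C-tight
-- fires at every threshold t with pg(w) > t + C -- on at least half of the uniformly random reduced
balanced words of length 2n over F_2, for all large n (stated as: for every such R, infinitely often
the tight fraction is < 1/2). Known sound certificates all stop at the Bavard/Calegari LP value
scl(w) (cl >= scl + 1/2; combs certify (1-eps)theta0 <= scl), so X says 'Bavard duality is the
optimal efficient certificate up to O(1) on random words'. P = NP gives the exact refuter, which is
0-tight everywhere (Assembly). pg = cl for reduced words (Culler1981; Bardakov formula Heuer2020 Thm
2.4). -/
@[route_item "route-PneNP-BavardGap", crux]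
def BavardGapUncertifiable : Prop :=
  ∃ C : ℕ, ∀ R : List (Fin 2 × Bool) × ℕ → Bool, Literature.Computability.Complexity.PolyTimeComputable (fun p : List (Fin 2 × Bool) × ℕ => Literature.Computability.Complexity.boolPair ((p.1).flatMap fun a => [decide (a.1 = 1), a.2]) (Computability.unaryEncodeNat p.2)) Computability.encodeBool R → (∀ (l : List (Fin 2 × Bool)) (t : ℕ), R (l, t) = true → ¬ (∃ π : Equiv.Perm (Fin (l).length), (∀ i, π (π i) = i) ∧ (∀ i, π i ≠ i) ∧ (∀ i, (l).get (π i) = (((l).get i).1, !((l).get i).2)) ∧ (l).length / 2 + 1 ≤ 2 * (t) + (Multiset.card (Equiv.Perm.cycleType ((finRotate (l).length).trans π)) + (Finset.univ.filter fun c => ((finRotate (l).length).trans π) c = c).card))) → ∃ᶠ n in Filter.atTop, ((((Finset.univ.filter fun w : Fin ((2 * n)) → Fin 2 × Bool => FreeGroup.reduce (List.ofFn w) = List.ofFn w ∧ ∀ a : Fin 2, (Finset.univ.filter fun i => w i = (a, true)).card = (Finset.univ.filter fun i => w i = (a, false)).card)).filter fun w => ∀ t : ℕ, ¬ (∃ π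 : Equiv.Perm (Fin (List.ofFn w).length), (∀ i, π (π i) = i) ∧ (∀ i, π i ≠ i) ∧ (∀ i, (List.ofFn w).get (π i) = (((List.ofFn w).get i).1, !((List.ofFn w).get i).2)) ∧ (List.ofFn w).length / 2 + 1 ≤ 2 * (t + C) + (Multiset.card (Equiv.Perm.cycleType ((finRotate (List.ofFn w).length).trans π)) + (Finset.univ.filter fun c => ((finRotate (List.ofFn w).length).trans π) c = c).card)) → R (List.ofFn w, t) = true).card : ℝ) / (((Finset.univ.filter fun w : Fin ((2 * n)) → Fin 2 × Bool => FreeGroup.reduce (List.ofFn w) = List.ofFn w ∧ ∀ a : Fin 2, (Finset.univ.filter fun i => w i = (a, true)).card = (Finset.univ.filter fun i => w i = (a, false)).card)).card : ℝ) < 1 / 2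

/-- item stmt-PneNP-2492 · crux · rank 2 · open · by planner
why it might fail: May be FALSE: chaining triangles along a single boundary copy has slack m^{1-2l} per junction (the same count as CW's combs, §4.5-4.7), so a one-sheet tripod gluing with bounded absorbers could give cl ~ scl (l -> 1/2); the refuting side ClAsymptoticToScl is filed.
sources: CalegariWalker2013 Thm 4.1, Lemma 3.7, Prop 4.2, Prop 4.9, §4.5-4.7, Culler1981, Heuer2020 Thm 2.4 (Bardakov formula), Example 2.3
[crux] First-order Bavard gap of a random word: there is q >= 1 such that Pr_{w uniform reduced
balanced of length m=2n}[pg(w) <= theta(m) + theta(m)/q] -> 0, theta(m) := m/(6*floor(log_3 m)) =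
Calegari-Walker's scl value log(3)m/(6 log m) up to 1+o(1). Equivalently cl of a random word is NOT
asymptotic to its scl (cl >= scl always; scl ~ theta whp by CalegariWalker2013 Thm 4.1). Decides
whether an explicit supercritical planting window exists (PlantedGlue). Most informative and
cheapest to attack: pure fatgraph combinatorics + CW's subword statistics; numerics (exhaustive
pairings vs scallop) give evidence at m <= 40. -/
@[route_item "route-PneNP-BavardGap"]
def FirstOrderGap : Prop :=
  ∃ q : ℕ, 0 < q ∧ Filter.Tendsto (fun n : ℕ => ((((Finset.univ.filter fun w : Fin ((2 * n)) → Fin 2 × Bool => FreeGroup.reduce (List.ofFn w) = List.ofFn w ∧ ∀ a : Fin 2, (Finset.univ.filter fun i => w i = (a, true)).card = (Finset.univ.filter fun i => w i = (a, false)).card)).filter fun w => (∃ π : Equiv.Perm (Fin (List.ofFn w).length), (∀ i, π (π i) = i) ∧ (∀ i, π i ≠ i) ∧ (∀ i, (List.ofFn w).get (π i) = (((List.ofFn w).get i).1, !((List.ofFn w).get i).2)) ∧ (List.ofFn w).length / 2 + 1 ≤ 2 * (((2 * n)) / (6 * Nat.log 3 ((2 * n))) + ((2 * n)) / (6 * Nat.log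 3 ((2 * n))) / q) + (Multiset.card (Equiv.Perm.cycleType ((finRotate (List.ofFn w).length).trans π)) + (Finset.univ.filter fun c => ((finRotate (List.ofFn w).length).trans π) c = c).card))).card : ℝ) / (((Finset.univ.filter fun w : Fin ((2 * n)) → Fin 2 × Bool => FreeGroup.reduce (List.ofFn w) = List.ofFn w ∧ ∀ a : Fin 2, (Finset.univ.filter fun i => w i = (a, true)).card = (Finset.univ.filter fun i => w i = (a, false)).card)).card : ℝ)) Filter.atTop (nhds 0)

/-- item stmt-PneNP-10857 · crux · rank 3 · open · by planner
why it might fail: scl is poly-time (Calegari2009) and depends on second-order subword statistics the planting perturbs; comb counts, suffix-structure and compression tests are neither low-degree nor local (HolmgrenWein2021 lesson); exact reducedness/balance of planted words may bias visible statistics.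
sources: Calegari2009, CalegariWalker2013 §4.2-4.3 (tripods), §4.5 (combs), HolmgrenWein2021 Thm 2, Hopkins2018 Conj 2.2.4, HarerZagier1986, tree: Summit.PneNP.PneNP.Theorems.BavardGapPlantedGenusPseudorandom_refuted (the n = 0 witness the repair evades)
[crux] REPAIRED PlantedGenusPseudorandom (stmt-PneNP-2493 was refuted-MISSTATED by
Theorems.BavardGapPlantedGenusPseudorandom_refuted: with the support clause for EVERY n, n = 0
(likewise n in {1,2,5}, where theta(2n) = 2n/(6*floor(log_3 2n)) = 0) admits no reduced balanced
word with a pairing of genus <= theta(1+1/q), while a PMF has non-empty support; the repair asks the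
support clause only EVENTUALLY in n -- admissible words exist for every n >= 6, e.g. a^{n-1} b
a^{1-n} b^{-1} of genus 1 <= theta(2n); nothing else changed). Quiet planting at every supercritical
genus: for every q >= 1 there is an EXACTLY polynomial-time samplable ensemble PL (a RandAlg S on
input 1^n, coins -> List Bool, IsPolyTime, whose output law is PL_n for every n) such that for all
large n PL_n is supported on 2-bit codes of reduced balanced words w of length 2n admitting a
letter/inverse-letter fixed-point-free pairing pi with |w|/2 + 1 <= 2(theta(2n) + theta(2n)/q) +
#cycles((finRotate |w|).trans pi) (genus <= theta + theta/q), and every PPT distinguisher D has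
advantage |Pr[D(1^n, PL_n) = 1] - Pr[D(1^n, NULL_n) = 1]| < 1/4 for infinitely many n (NULL_n =
uniform reduced balanced word of length 2n, code -/
@[route_item "route-PneNP-BavardGap"]
def PlantedGenusPseudorandomR : Prop :=
  ∀ q : ℕ, 0 < q → ∃ PL : ℕ → PMF (List Bool), (∃ S : Literature.Computability.Complexity.RandAlg ℕ (List Bool), S.IsPolyTime Computability.unaryEncodeNat id ∧ ∀ n : ℕ, S.outputPMF Computability.unaryEncodeNat n = PL n) ∧ (∀ᶠ n in Filter.atTop, ∀ x ∈ (PL n).support, ∃ w : Fin (2 * n) → Fin 2 × Bool, w ∈ (Finset.univ.filter fun w : Fin ((2 * n)) → Fin 2 × Bool => FreeGroup.reduce (List.ofFn w) = List.ofFn w ∧ ∀ a : Fin 2, (Finset.univ.filter fun i => w i = (a, true)).card = (Finset.univ.filter fun i => w i = (a, false)).card) ∧ x = ((List.ofFn w).flatMap fun a => [decide (a.1 = 1), a.2]) ∧ (∃ π : Equiv.Perm (Fin (List.ofFn w).length), (∀ i, π (π i) = i) ∧ (∀ i, π i ≠ i) ∧ (∀ i, (List.ofFn w).get (π i) = (((List.ofFn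 w).get i).1, !((List.ofFn w).get i).2)) ∧ (List.ofFn w).length / 2 + 1 ≤ 2 * (((2 * n)) / (6 * Nat.log 3 ((2 * n))) + ((2 * n)) / (6 * Nat.log 3 ((2 * n))) / q) + (Multiset.card (Equiv.Perm.cycleType ((finRotate (List.ofFn w).length).trans π)) + (Finset.univ.filter fun c => ((finRotate (List.ofFn w).length).trans π) c = c).card))) ∧ ∀ D : Literature.Computability.Complexity.RandAlg (List Bool) Bool, D.IsPolyTime id Computability.encodeBool → ∃ᶠ n in Filter.atTop, |(((PL n).bind fun s => D.outputPMF id (Literature.Computability.Complexity.boolPair (Computability.unaryEncodeNat n) s)) true).toReal - ((((if h : ((Finset.univ.filter fun w : Fin ((2 * n)) → Fin 2 × Bool => FreeGroup.reduce (List.ofFn w) = List.ofFn w ∧ ∀ a : Fin 2, (Finset.univ.filter fun i => w i = (a, true)).card = (Finset.univ.filter fun i => w i = (a, false)).card)).Nonempty then (PMF.uniformOfFinset ((Finset.univ.filter fun w : Fin ((2 * n)) → Fin 2 × Bool => FreeGroup.reduce (List.ofFn w) = List.ofFn w ∧ ∀ a : Fin 2, (Finset.univ.filter fun i => w i = (a,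 true)).card = (Finset.univ.filter fun i => w i = (a, false)).card)) h).map (fun w => ((List.ofFn w).flatMap fun a => [decide (a.1 = 1), a.2])) else PMF.pure [])).bind fun s => D.outputPMF id (Literature.Computability.Complexity.boolPair (Computability.unaryEncodeNat n) s)) true).toReal| < 1 / 4

/-- item stmt-PneNP-10858 · crux · rank 4 · open · by planner
why it might fail: Planted band junctions and exact reducedness/balance constraints create degree-polylog-visible biases unless the planting is posterior-matched; uniform genus-g gluings have the wrong face-degree profile (refuter-14's flaw), and coloured multi-matrix correlators may not close.
sources: HarerZagier1986, KuniskyWeinBandeira2019 Def 1.14, Prop 1.15, Hopkins2018 §2.3, CalegariWalker2013 §2 (subword statistics at scale log m), HolmgrenWein2021 Def 1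
[crux] REPAIRED LowDegreeQuietPlanting (pre-emptive 1:1 restatement, same defect class as
stmt-PneNP-2493: with `for every n` the item fails at n = 1, where no reduced balanced word of
length 2 exists so f == 1 gives 1 <= B*0, and at n in {0,2,5} where theta(2n) = 0 admits no pairing;
now BOTH the support clause and the moment inequality are asked only eventually in n). Low-degree
rung of the planting: for every q >= 1 there are B and laws PL_n on words Fin 2n -> letters such
that for all large n: PL_n is supported on reduced balanced words admitting a pairing of genus <=
theta(2n) + theta(2n)/q, and for every f in the real span of juntas on <= (floor(log_2 2n))^2 letter
positions, (E_{PL_n} f)^2 <= B * E_{NULL_n}[f^2] (E_NULL = average over the reduced balanced words)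
-- i.e. the squared low-degree likelihood ratio ||L^{<=D}||^2 w.r.t. the non-product null is <= B
uniformly in n (variational form). The statistics are face/corner correlators of random gluings:
Harer-Zagier / Wick calculus for letter-coloured one-vertex maps; degree (log m)^2 includes all comb
statistics of bounded complexity. Evidence for PlantedGenusPseudorandomR, never a substitute (no
low-degree-to-PPT transfer -/
@[route_item "route-PneNP-BavardGap"]
def LowDegreeQuietPlantingR : Prop :=
  ∀ q : ℕ, 0 < q → ∃ B : ℝ, ∃ PL : (n : ℕ) → PMF (Fin (2 * n) → Fin 2 × Bool), ∀ᶠ n in Filter.atTop, (∀ w ∈ (PL n).support, w ∈ (Finset.univ.filter fun w : Fin ((2 * n)) → Fin 2 × Bool => FreeGroup.reduce (List.ofFn w) = List.ofFn w ∧ ∀ a : Fin 2, (Finset.univ.filter fun i => w i = (a, true)).card = (Finset.univ.filter fun i => w i = (a, false)).card) ∧ (∃ π : Equiv.Perm (Fin (List.ofFn w).length), (∀ i, π (π i) = i) ∧ (∀ i, π i ≠ i) ∧ (∀ i, (List.ofFn w).get (π i) = (((List.ofFn w).get i).1, !((List.ofFn w).get i).2)) ∧ (List.ofFn w).length / 2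 + 1 ≤ 2 * (((2 * n)) / (6 * Nat.log 3 ((2 * n))) + ((2 * n)) / (6 * Nat.log 3 ((2 * n))) / q) + (Multiset.card (Equiv.Perm.cycleType ((finRotate (List.ofFn w).length).trans π)) + (Finset.univ.filter fun c => ((finRotate (List.ofFn w).length).trans π) c = c).card))) ∧ ∀ f : (Fin (2 * n) → Fin 2 × Bool) → ℝ, f ∈ Submodule.span ℝ {h : (Fin (2 * n) → Fin 2 × Bool) → ℝ | ∃ T : Finset (Fin (2 * n)), T.card ≤ (Nat.log 2 (2 * n)) ^ 2 ∧ ∀ x y : Fin (2 * n) → Fin 2 × Bool, (∀ i ∈ T, x i = y i) → h x = h y} → (∑ w, (PL n w).toReal * f w) ^ 2 ≤ B * ((∑ w ∈ (Finset.univ.filter fun w : Fin ((2 * n)) → Fin 2 × Bool => FreeGroup.reduce (List.ofFn w) = List.ofFn w ∧ ∀ a : Fin 2, (Finset.univ.filter fun i => w i = (a, true)).card = (Finset.univ.filter fun i => w i = (a, false)).card), f w ^ 2) / (((Finset.univ.filter fun w : Fin ((2 * n)) → Fin 2 × Bool => FreeGroup.reduce (List.ofFn w) = List.ofFn w ∧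 ∀ a : Fin 2, (Finset.univ.filter fun i => w i = (a, true)).card = (Finset.univ.filter fun i => w i = (a, false)).card)).card : ℝ))

/-- item stmt-PneNP-2495 · crux · rank 5 · open · by planner
why it might fail: cl - scl could be O(1) in probability: multi-sheet extremal surfaces (Calegari2009 rationality, finite covering degree) might be matched by one-sheet surfaces up to bounded absorbers; nothing beyond cl >= scl + 1/2 is known for random words.
sources: Calegari2009, CalegariWalker2013 Thm 4.1, Remark 4.15, Heuer2020 §2.2 (gap 1/2), Example 2.3, Culler1981
[crux] Second-order lifeline of X: for every K, Pr_{w}[pg(w) <= scl(w) + K] -> 0 over uniform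
reduced balanced words of length 2n, where scl is stated inline as inf_k cl(x^{k+1})/(k+1) with
cl(x) = least length of a list of commutators with product x in FreeGroup (Fin 2) (pg >= cl >= scl).
Says the Bavard integrality gap of a random word tends to infinity in probability; it keeps X
consistent with Calegari's polynomial-time scl for EVERY C (the LP certificate ceil(scl + 1/2) is
then never C-tight on half the words), whether or not FirstOrderGap holds. Only cl >= scl + 1/2
(Duncan-Howie gap, Heuer2020 §2.2) is known. -/
@[route_item "route-PneNP-BavardGap"]
def GapDivergesInProbability : Prop :=
  ∀ K : ℕ, Filter.Tendsto (fun n : ℕ => ((((Finset.univ.filter fun w : Fin ((2 * n)) → Fin 2 × Bool => FreeGroup.reduce (List.ofFn w) = List.ofFn w ∧ ∀ a : Fin 2, (Finset.univ.filter fun i => w i = (a, true)).card = (Finset.univ.filter fun i => w i = (a, false)).card)).filter fun w => (((sInf {t : ℕ | (∃ π : Equiv.Perm (Fin (List.ofFn w).length), (∀ i, π (π i) = i) ∧ (∀ i, π i ≠ i) ∧ (∀ i, (List.ofFn w).get (π i) = (((List.ofFn w).get i).1, !((List.ofFn w).get i).2)) ∧ (List.ofFn w).length / 2 + 1 ≤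 2 * (t) + (Multiset.card (Equiv.Perm.cycleType ((finRotate (List.ofFn w).length).trans π)) + (Finset.univ.filter fun c => ((finRotate (List.ofFn w).length).trans π) c = c).card))}) : ℕ) : ℝ) ≤ ((fun x : FreeGroup (Fin 2) => ⨅ k : ℕ, (((fun x : FreeGroup (Fin 2) => sInf {g : ℕ | ∃ l : List (FreeGroup (Fin 2) × FreeGroup (Fin 2)), l.length = g ∧ (l.map fun p => p.1 * p.2 * p.1⁻¹ * p.2⁻¹).prod = x})) (x ^ (k + 1)) : ℝ) / ((k : ℝ) + 1))) (FreeGroup.mk (List.ofFn w)) + K).card : ℝ) / (((Finset.univ.filter fun w : Fin ((2 * n)) → Fin 2 × Bool => FreeGroup.reduce (List.ofFn w) = List.ofFn w ∧ ∀ a : Fin 2, (Finset.univ.filter fun i => w i = (a, true)).card = (Finset.univ.filter fun i => w i = (a, false)).card)).card : ℝ)) Filter.atTop (nhds 0)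

/-- item stmt-PneNP-10859 · support · rank 9 · closed · proved by Summit.PneNP.PneNP.Theorems.bavardGap_plantedGlueR_proof @ ecf033093e84 (prover) · by planner
sources: Feige2002 §1.1 (shape of the argument), tree: Literature.Computability.Complexity.PolyTimeComputable.comp_holds, RandAlg IsPolyTime.ofDet_holds
[support] Glue FirstOrderGap -> PlantedGenusPseudorandomR -> BavardGapUncertifiable (rev 2:
re-pointed at the repaired crux; provable now, machine plumbing only). Towards not-X at C = 0
suppose a sound poly-time refuter R is 0-tight on >= half of NULL_n for all large n; take q0 from
FirstOrderGap, PL from PlantedGenusPseudorandomR at q = q0, and the deterministic distinguisher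
D(1^n, x) := R(decode x, theta(2n) + theta(2n)/q0) (RandAlg.ofDet; PPT by IsPolyTime.ofDet_holds +
PolyTimeComputable.comp_holds: parse boolPair(unary n)(code w), compute the threshold, re-encode,
run R). For all large n: on PL_n the planted pairing has genus <= threshold, so soundness forces D =
0 (the support clause holds eventually -- enough); on NULL_n, D = 1 whenever R is tight at w and
pg(w) > theta + theta/q0, which has probability >= 1/2 - o(1) by FirstOrderGap; hence advantage >=
1/4 for all large n, contradicting the crux's `advantage < 1/4 infinitely often`. -/
@[route_item "route-PneNP-BavardGap"]
def PlantedGlueR : Prop :=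
  FirstOrderGap → PlantedGenusPseudorandomR → BavardGapUncertifiable

/-- item stmt-PneNP-2496 · support · rank 9 · open · by planner
sources: CalegariWalker2013 Prop 4.2, Prop 4.9, Lemma 3.7
[support] Refuting side of FirstOrderGap (filed so it is provable as a theorem in its own right:
'commutator length of a random word'): for every q >= 1, Pr[pg(w) <= theta(2n) + theta(2n)/q] -> 1,
i.e. cl(w) = (1+o(1)) log(3) m/(6 log m) = (1+o(1)) scl(w) whp. A proof would be a single-sheet
version of Calegari-Walker's tripod construction (Prop 4.2) with an absorber for unmatched mass; the
lower bound cl >= scl >= (1-eps)theta is CW Prop 4.9. If proved,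
PlantedGenusPseudorandom/LowDegreeQuietPlanting lose their explicit window (kill criterion for the
planted mechanism; X then rests on GapDivergesInProbability). -/
@[route_item "route-PneNP-BavardGap"]
def ClAsymptoticToScl : Prop :=
  ∀ q : ℕ, 0 < q → Filter.Tendsto (fun n : ℕ => ((((Finset.univ.filter fun w : Fin ((2 * n)) → Fin 2 × Bool => FreeGroup.reduce (List.ofFn w) = List.ofFn w ∧ ∀ a : Fin 2, (Finset.univ.filter fun i => w i = (a, true)).card = (Finset.univ.filter fun i => w i = (a, false)).card)).filter fun w => (∃ π : Equiv.Perm (Fin (List.ofFn w).length), (∀ i, π (π i) = i) ∧ (∀ i, π i ≠ i) ∧ (∀ i, (List.ofFn w).get (π i) = (((List.ofFn w).get i).1, !((List.ofFn w).get i).2)) ∧ (List.ofFn w).length / 2 + 1 ≤ 2 * (((2 * n)) / (6 * Nat.log 3 ((2 * n))) + ((2 * n)) / (6 * Nat.log 3 ((2 * n))) / q) + (Multiset.card (Equiv.Perm.cycleType ((finRotate (List.ofFn w).length).trans π)) + (Finset.univ.filter fun c => ((finRotate (List.ofFn w).length).trans π) c = c).card))).card : ℝ) / (((Finset.univ.filter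 fun w : Fin ((2 * n)) → Fin 2 × Bool => FreeGroup.reduce (List.ofFn w) = List.ofFn w ∧ ∀ a : Fin 2, (Finset.univ.filter fun i => w i = (a, true)).card = (Finset.univ.filter fun i => w i = (a, false)).card)).card : ℝ)) Filter.atTop (nhds 1)

/-- item stmt-PneNP-2497 · support · rank 9 · open · by planner
sources: CalegariWalker2013 Lemma 3.7, Prop 4.9, Lemmas 4.12-4.14, Calegari2009, Culler1981
[support] The lower edge of the window, made effective (planner's reading of CalegariWalker2013
§4.5-4.7, to be proved): for every q >= 1 there is a polynomial-time SOUND refuter R (R(w,t)=true =>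
pg(w) > t) that fires at threshold theta(2n) - theta(2n)/q with probability -> 1 over uniform
reduced balanced words. Two proofs are possible: (a) comb search -- R checks 'few inverse repeats of
length >= (1+delta)lambda, local distinctness, and no delta-regular comb of complexity d = O(q) with
L/(2d+1) > 1/2 + 1/(4q)' in time m^{O(d)}; soundness for ALL words via Culler's fatgraph + Lemma 3.7
averaging + Lemma 4.12, completeness on random words via Lemma 4.14; (b) Calegari's LP: R fires iff
t < scl(w) (cl >= scl), complete by CW Prop 4.9 -- needs scl in FP formalised. Documents why the
route never plants below theta. -/
@[route_item "route-PneNP-BavardGap"]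
def CombRefutation : Prop :=
  ∀ q : ℕ, 0 < q → ∃ R : List (Fin 2 × Bool) × ℕ → Bool, Literature.Computability.Complexity.PolyTimeComputable (fun p : List (Fin 2 × Bool) × ℕ => Literature.Computability.Complexity.boolPair ((p.1).flatMap fun a => [decide (a.1 = 1), a.2]) (Computability.unaryEncodeNat p.2)) Computability.encodeBool R ∧ (∀ (l : List (Fin 2 × Bool)) (t : ℕ), R (l, t) = true → ¬ (∃ π : Equiv.Perm (Fin (l).length), (∀ i, π (π i) = i) ∧ (∀ i, π i ≠ i) ∧ (∀ i, (l).get (π i) = (((l).get i).1, !((l).get i).2)) ∧ (l).length / 2 + 1 ≤ 2 * (t) + (Multiset.card (Equiv.Perm.cycleType ((finRotate (l).length).trans π)) + (Finset.univ.filter fun c => ((finRotate (l).length).trans π) c = c).card))) ∧ Filter.Tendsto (fun n : ℕ => ((((Finset.univ.filter fun w : Fin ((2 * n)) → Fin 2 × Bool => FreeGroup.reduce (List.ofFn w) = List.ofFn w ∧ ∀ a : Fin 2, (Finset.univ.filter fun i => w i = (a, true)).card = (Finset.univ.filter fun i => w i = (a, false)).card)).filter fun w => R (List.ofFn w, ((2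 * n)) / (6 * Nat.log 3 ((2 * n))) - ((2 * n)) / (6 * Nat.log 3 ((2 * n))) / q) = true).card : ℝ) / (((Finset.univ.filter fun w : Fin ((2 * n)) → Fin 2 × Bool => FreeGroup.reduce (List.ofFn w) = List.ofFn w ∧ ∀ a : Fin 2, (Finset.univ.filter fun i => w i = (a, true)).card = (Finset.univ.filter fun i => w i = (a, false)).card)).card : ℝ)) Filter.atTop (nhds 1)

/-- item stmt-PneNP-2498 · support · rank 9 · closed · proved by Summit.PneNP.PneNP.Theorems.bavardGap_pgDecisionInNP_proof @ 116e2945c9de (prover) · by planner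
sources: Heuer2020 Thm 2.4, Cor 2.5
[support] The pairing-genus decision language {boolPair(code(w))(unary t) : w has a
letter/inverse-letter fixed-point-free pairing pi with |w|/2 + 1 <= 2t + #cycles((finRotate
|w|).trans pi)} is in NP (tree class Nondeterministic.NP): witness = pi, verification = cycle
counting in polynomial time (Heuer2020 Cor 2.5; Bardakov's formula Thm 2.4 identifies the bound with
cl(w) <= t for cyclically reduced w, not needed here). Machine-level but routine; used by the
Assembly (P = NP => exact refuter). -/
@[route_item "route-PneNP-BavardGap", crux]
def PgDecisionInNP : Prop :=
  ({x : List Bool | ∃ (l : List (Fin 2 × Bool)) (t : ℕ), x = Literature.Computability.Complexity.boolPair ((l).flatMap fun a => [decide (a.1 = 1), a.2]) (Computability.unaryEncodeNat t) ∧ (∃ π : Equiv.Perm (Fin (l).length), (∀ i, π (π i) = i) ∧ (∀ i, π i ≠ i) ∧ (∀ i, (l).get (π i) = (((l).get i).1, !((l).get i).2)) ∧ (l).length / 2 + 1 ≤ 2 * (t) + (Multiset.card (Equiv.Perm.cycleType ((finRotate (l).length).trans π)) + (Finset.univ.filter fun c => ((finRotate (l).length).trans π) c = c).card))} : Language Bool)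 ∈ Literature.Computability.Complexity.Nondeterministic.NP

-- item stmt-PneNP-2680 · support · rank 9 · open · by planner — informal only, no Lean statement yet:
--   [support] Worst-case floor (informal until the cite fact "CL-F is NP-complete" (Heuer2020 Thm 1)
--   lands as a named Literature Prop H): H → (PgLanguage ∈ Classes.P ↔ ¬ PneNP), where PgLanguage is the
--   pairing-genus decision language of PgDecisionInNP. Records that the worst-case version of the line
--   is summit-equivalent (Heuer2020 Thm 1 + Cor 2.5 with the Wave0 bridges), so the content of the route
--   is the average-case target BavardGapUncertifiable. Not a crux; do not staff before H exists.
--   [sources: Heuer2020 Thm 1, Cor 2.5]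

-- earlier Assembly (stmt-PneNP-2500, replaced 2026-08-15T16:26:17Z -> stmt-PneNP-10860): retired by None — (Literature.Computability.Complexity.PNPWave0.P Bool = Literature.Computability.Complexity.Classes.P) → (Literature.Computability.Complexity.PNPWave0.NP Bool = Literature.Computability.Complexity.Nondeterministic.NP) → BavardGapUncertifiable → PgDecisionInNP → PneNP
/-- item stmt-PneNP-10860 · assembly · rank 1 · closed · proved by Summit.PneNP.PneNP.Theorems.bavardGap_assembly_proof @ 6f2b99091c07 (prover) · by planner
sources: tree: Literature.Computability.Complexity.P_bool_eq_holds, NP_bool_eq_holds, mem_P_iff_holds, co_P_holds, Heuer2020 Cor 2.5, CookClay2006 §1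
[assembly] BavardGapUncertifiable -> PgDecisionInNP -> PneNP (rev 2: the Wave0 model bridges
`PNPWave0.P Bool = Classes.P`, `PNPWave0.NP Bool = Nondeterministic.NP` are the PROVED tree theorems
Literature.Computability.Complexity.P_bool_eq_holds (ClayProblem.lean) and NP_bool_eq_holds
(ClayProblemProofs.lean) -- used INSIDE the proof and imported by the Theorems file, no longer
hypotheses of this item; likewise mem_P_iff_holds, co_P_holds (Classes.lean)). Contrapositive: not
PneNP gives PNPWave0.NP Bool ⊆ PNPWave0.P Bool, hence Nondeterministic.NP ⊆ Classes.P; with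
PgDecisionInNP the genus language PG is in P, so is its complement (co_P_holds), so one machine
decides PG^c in polynomial time for the identity encoding (mem_P_iff_holds); the SAME machine
witnesses PolyTimeComputable enc encodeBool R for R(w,t) := [enc(w,t) ∉ PG], enc(w,t) =
boolPair(2-bit letter code of w)(unary t) (no composition needed: the time bound is read at
|enc(w,t)|). R is sound (R true => enc(w,t) ∉ PG => no admissible pairing at t) and 0-tight at every
word (not PgLE w (t+C) => not PgLE w t by monotonicity in t => enc(w,t) ∉ PG by injectivity of
boolPair / letter code / unary => R true); reduced balanced wo -/
@[route_item "route-PneNP-BavardGap", crux]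
def Assembly : Prop :=
  BavardGapUncertifiable → PgDecisionInNP → PneNP

-- records of items no longer active in this route (dropped / restated):
-- earlier PlantedGenusPseudorandom (stmt-PneNP-2493, replaced 2026-08-15T16:26:17Z -> stmt-PneNP-10857): refuted by Summit.PneNP.PneNP.Theorems.BavardGapPlantedGenusPseudorandom_refuted @ effcd627efb9 — ∀ q : ℕ, 0 < q → ∃ PL : ℕ → PMF (List Bool), (∃ S : Literature.Computability.Complexity.RandAlg ℕ (List Bool), S.IsPolyTime Computability.unaryEncodeNat id ∧ ∀ n : ℕ, S.outputPMF Computability.unaryE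
-- earlier LowDegreeQuietPlanting (stmt-PneNP-2494, replaced 2026-08-15T16:26:17Z -> stmt-PneNP-10858): retired by None — ∀ q : ℕ, 0 < q → ∃ B : ℝ, ∃ PL : (n : ℕ) → PMF (Fin (2 * n) → Fin 2 × Bool), (∀ n : ℕ, ∀ w ∈ (PL n).support, w ∈ (Finset.univ.filter fun w : Fin ((2 * n)) → Fin 2 × Bool => FreeGroup.reduce (List.ofFn w) = List.ofFn w ∧ ∀ a : Fin 2, (Finset.univ.filter fun i => w i = (a, true)).ca
-- earlier PlantedGlue (stmt-PneNP-2499, replaced 2026-08-15T16:26:17Z -> stmt-PneNP-10859): retired by None — FirstOrderGap → PlantedGenusPseudorandom → BavardGapUncertifiable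

/-! D-0027 §2.1 — DECIDING THEOREM (planner-authored via `route open/edit --closes-file`; by planner-rbadge-PneNP-BavardGap-0c84121b-g2-0 2026-08-15T16:26:17Z):
its hypotheses are this route's items and its conclusion the sub-problem Statement (glue_lint), and it elaborates with this file. -/

@[closes "route-PneNP-BavardGap"] theorem closes (hX : BavardGapUncertifiable) (hPg : PgDecisionInNP) (hA : Assembly) : _root_.PneNP :=
  hA hX hPg

end Summit.PneNP.PneNP.Theses.BavardGap
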